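import Summits.QuantumFields.GaugeBoot.ClassBIdentification
import Summits.QuantumFields.GaugeBoot.CubicTorusLinkRPAnyBeta
import Summits.QuantumFields.GaugeBoot.CubicTorusLinkRPTwoDim
import Summits.QuantumFields.GaugeBoot.CubicTorusWave0Classes
import Literature.MathematicalPhysics.QuantumLattice.LatticeGaugeDLRLimitPointsProofs
import HarnessLib

/-!
# Plain link RP of even-torus limit points at EVERY real coupling
(gauge-boot, Class-B brick; the link family at `β < 0`, part 1/2)

HONEST FRAMING (cell `pub-gaugeboot`, page 1 of every file): the venture produces certified bounds
on lattice expectations at stated coupling, gauge group, dimension and torus size; NOT a mass gap,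
NOT a continuum limit, NOT a string tension; NOT Yang–Mills-summit-bearing (barriers
`FixedCouplingUltralocality`, `PerturbativeInvisibility`). Structural bookkeeping (which SDP blocks
are exact for which infinite-volume states); certifies no number.

## Content

`ClassBLimitLinkRP.lean` proved the plain link RP of `ClassB.lean` (all bounded measurable
observables of the half `{x_i ≥ 1}`, mirror `x_i = ½`) for every infinite-volume limit point of the
torus Wilson states at `β ≥ 0`, from Wave 0's torus theorems (even and odd sides). On the EVEN torus
the tree also holds link RP at EVERY real `β` — `CubicTorusLinkRPAnyBeta.lean` (central involution
`z`, `ρ z = -1`: `SU(2)`, `SU(2n)`, `U(N)` fundamental; staggered central twist `β ↦ -β`) and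
`CubicTorusLinkRPTwoDim.lean` (`d = 2`, every compact `G`). This module transfers those to the
limit points ALONG EVEN SIZES:

* `exists_isInfiniteVolumeLimitAlong_even` — for every continuous `ρ` and real `β` there is a
  limit point of the torus Wilson states along EVEN torus sizes `2φ(k) + 4`, `φ` strictly
  increasing (compactness, as `infiniteVolumeLimitPoints_nonempty_holds`);
  `mem_infiniteVolumeLimitPoints_of_along_even` — it is an infinite-volume limit point;
* `integral_linkReflect_nonneg_of_cylinder_along` / `linkRP_zero_of_isInfiniteVolumeLimitAlong` /
  `linkRP_of_isInfiniteVolumeLimitAlong` — the transfer of `ClassBLimitLinkRP.lean` with the torus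
  input ABSTRACTED: if, for every half-space cylinder support, the torus RP pairing of the lift is
  eventually `≥ 0` along the defining sequence of sizes, the limit is
  `IsReflectionPositiveFor (configLinkReflect i) (linkHalfEdges i)` in every axis `i` (the `L²`
  closure `IsReflectionPositiveFor.of_continuous_cylinder`, transport by axis transpositions);
* `evenTorus_linkRP_timeReflect_anyBeta_of_central` / `evenTorus_linkRP_timeReflect_twoDim` — the
  two even-torus link theorems along the axis `0` in Wave 0's vocabulary (`timeReflect`,
  `IsPositiveTimeObservable`; bridges `configMidReflect_cubicUnit_zero`,
  `isMidObservable_cubicUnit_zero_iff` of `CubicTorusFrames` / `CubicTorusWave0Classes`), for every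
  even `L ≥ 4`;
* ★★ **`linkRP_of_isInfiniteVolumeLimitAlong_even_of_central`** — `G : Type` compact Hausdorff
  second countable with a central involution `z`, `ρ` continuous with `ρ z = -1`, ANY real `β`, any
  `d ≥ 1`: every limit point along even sizes is plainly link-RP in EVERY axis;
  ★★ **`linkRP_of_isInfiniteVolumeLimitAlong_even_twoDim`** — the same on `ℤ²` for EVERY compact
  `G` and continuous `ρ`.

Part 2 (`LinkRPPlainVsCovariant.lean`) combines this with `CovariantLinkRPNegativeCoupling.lean`:
at `β < 0` these states are plainly link-RP in every axis and covariantly link-RP in none.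

What this does NOT say: nothing about limit points along odd sizes at `β < 0` (the twist needs
mod-2 parities); nothing about `SU(2n+1)` in `d ≥ 3` (there link RP FAILS on the even torus at
`β < 0` for `3 ≤ N ≤ 2d - 3`, `CubicTorusLinkRPNegativeBetaOdd.lean`); no number.

Elementary; not in print in this form as far as the cell's searches go (OS link RP: Osterwalder–
Seiler 1978 §2, Seiler LNP 159 Thm. 2.2, Montvay–Münster 1994 pp. 180–185; `Z(-β)` symmetry of
`SU(2N)` on even lattices: Li–Meurice, Phys. Rev. D 71 (2005) 016008).
-/

noncomputable section

open MeasureTheory Filter Topology Complex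
open scoped ComplexOrder ComplexConjugate
open Literature.Probability.LatticeModels (Site)
open Literature.MathematicalPhysics.QuantumLattice
open Literature.MathematicalPhysics.QuantumFieldTheory (GaugeConfig Edge wilsonExpectation
  wilsonMeasure isProbabilityMeasure_wilsonMeasure measurable_torusLift
  torusState isProbabilityMeasure_torusState wilsonExpectation_toTorusObservable
  IsPositiveTimeObservable haarProbability)

namespace Summit.QuantumFields.GaugeBoot

variable {d N : ℕ} {G : Type*} [Group G] [TopologicalSpace G] [IsTopologicalGroup G]
  [CompactSpace G] [MeasurableSpace G] [BorelSpace G]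
variable (ρ : G →* Matrix (Fin N) (Fin N) ℂ)

/-! ## Limit points along even torus sizes exist -/

section Existence

variable [T2Space G] [SecondCountableTopology G]

/-- **Limit points along EVEN torus sizes exist**: for a continuous `ρ` and every real `β`, the
torus Wilson states of the even tori `(ℤ/(2φ(k) + 4))^d` converge, along some strictly increasing
`φ`, on all bounded continuous cylinder observables to a probability measure on `LGConfig d G`
(compactness of the probability measures on the compact metrisable `G^{edges}`; as
`infiniteVolumeLimitPoints_nonempty_holds`). The sizes are written `(2φ(k) + 3) + 1`. -/
theorem exists_isInfiniteVolumeLimitAlong_even (hρ : Continuous ρ) (β : ℝ) :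
    ∃ (μ : Measure (LGConfig d G)) (φ : ℕ → ℕ), StrictMono φ ∧
      IsInfiniteVolumeLimitAlong ρ β (fun k => 2 * φ k + 3) μ := by
  haveI := fun n : ℕ => isProbabilityMeasure_torusState (d := d) (L := 2 * n + 3 + 1) ρ hρ β
  let P : ℕ → ProbabilityMeasure (LGConfig d G) := fun n => ⟨torusState ρ β (2 * n + 3 + 1), inferInstance⟩
  obtain ⟨μ, -, φ, hφ, hlim⟩ :=
    (isCompact_univ (X := ProbabilityMeasure (LGConfig d G))).tendsto_subseq
      fun n => Set.mem_univ (P n)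
  refine ⟨(μ : Measure (LGConfig d G)), φ, hφ, inferInstance, fun F S _ hFc hFb => ?_⟩
  obtain ⟨C, hC⟩ := hFb
  let Fb : BoundedContinuousFunction (LGConfig d G) ℝ :=
    BoundedContinuousFunction.ofNormedAddCommGroup F hFc C
      (fun U => by simpa [Real.norm_eq_abs] using hC U)
  have hE : (fun k : ℕ => wilsonExpectation (L := 2 * φ k + 3 + 1) ρ β
      (toTorusObservable (2 * φ k + 3 + 1) F)) =
      fun k => ∫ U, Fb U ∂(P (φ k) : Measure (LGConfig d G)) :=
    funext fun k => wilsonExpectation_toTorusObservable ρ β (2 * φ k + 3 + 1) hFc.measurable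
  have key : Tendsto (fun k : ℕ => ∫ U, Fb U ∂(P (φ k) : Measure (LGConfig d G))) atTop
      (𝓝 (∫ U, Fb U ∂(μ : Measure (LGConfig d G)))) :=
    (ProbabilityMeasure.tendsto_iff_forall_integral_tendsto.1 hlim) Fb
  rw [hE]
  exact key

omit [T2Space G] [SecondCountableTopology G] in
/-- The even sizes `k ↦ 2φ(k) + 3` (`+ 1`) increase strictly with `φ`. -/
theorem strictMono_evenSizes {φ : ℕ → ℕ} (hφ : StrictMono φ) :
    StrictMono (fun k => 2 * φ k + 3) := fun a b hab => by
  have := hφ hab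
  change 2 * φ a + 3 < 2 * φ b + 3
  omega

omit [T2Space G] [SecondCountableTopology G] in
/-- A limit along the even sizes `2φ(k) + 4`, `φ` strictly increasing, is an infinite-volume limit
point. -/
theorem mem_infiniteVolumeLimitPoints_of_along_even {β : ℝ} {μ : Measure (LGConfig d G)}
    {φ : ℕ → ℕ} (hφ : StrictMono φ) (hμ : IsInfiniteVolumeLimitAlong ρ β (fun k => 2 * φ k + 3) μ) :
    μ ∈ infiniteVolumeLimitPoints (d := d) ρ β :=
  ⟨fun k => 2 * φ k + 3, strictMono_evenSizes hφ, hμ⟩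

end Existence

/-! ## The transfer with the torus input abstracted -/

section Transfer

variable [NeZero d] [SecondCountableTopology G]

/-- **Transfer of link RP to a limit, torus input abstracted.** Let `μ` be the limit of the torus
Wilson states along the sizes `L(k) + 1`, and `F` a bounded continuous cylinder observable of the
half `{x_0 ≥ 1}`. If for every half-space support datum (`T' ⊆ {1 ≤ x_0 ≤ m}` with `F` a
`T'`-cylinder) the torus RP pairing `⟨conj(F∘lift∘Θ) · (F∘lift)⟩_{L(k)+1}` is eventually
non-negative, then `0 ≤ ∫ conj F(Θ_0 U) · F(U) dμ`. (The proof of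
`integral_linkReflect_nonneg_of_cylinder`, verbatim, with `torus_rp_nonneg` replaced by the
hypothesis.) -/
theorem integral_linkReflect_nonneg_of_cylinder_along (hρ : Continuous ρ) {β : ℝ} {L : ℕ → ℕ}
    {μ : Measure (LGConfig d G)} (hμ : IsInfiniteVolumeLimitAlong ρ β L μ)
    {F : LGConfig d G → ℂ} {T : Finset (ZdEdge d)} (hFT : IsCylinder F T) (hFc : Continuous F)
    {C : ℝ} (hC : ∀ U, ‖F U‖ ≤ C) (hFS : DependsOn F (linkHalfEdges 0))
    (htorus : ∀ (T' : Finset (ZdEdge d)) (m : ℕ), IsCylinder F T' → (∀ e ∈ T', 1 ≤ e.1 0) →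
      (∀ e ∈ T', e.1 0 ≤ m) → ∀ᶠ k in atTop,
        0 ≤ wilsonExpectation (L := L k + 1) ρ β fun U : GaugeConfig d (L k + 1) G =>
          conj (toTorusObservable (L k + 1) F U.timeReflect) * toTorusObservable (L k + 1) F U) :
    0 ≤ ∫ U, conj (F (configLinkReflect 0 U)) * F U ∂μ := by
  classical
  obtain ⟨hprob, hconv⟩ := hμ
  haveI := hprob
  -- support inside the half
  set T' : Finset (ZdEdge d) := T.filter (· ∈ linkHalfEdges (d := d) 0) with hT'
  have hFT' : IsCylinder F T' := isCylinder_filter_of_dependsOn hFT hFS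
  have hT1 : ∀ e ∈ T', 1 ≤ e.1 0 := fun e he => (Finset.mem_filter.1 he).2
  obtain ⟨m, hm⟩ : ∃ m : ℕ, ∀ e ∈ T', e.1 0 ≤ m := by
    refine ⟨T'.sup fun e => (e.1 0).toNat, fun e he => ?_⟩
    have hle := Finset.le_sup (f := fun e : ZdEdge d => (e.1 0).toNat) he
    have h0 : 0 ≤ e.1 0 := by have := hT1 e he; omega
    have : (e.1 0).toNat ≤ T'.sup fun e : ZdEdge d => (e.1 0).toNat := hle
    omega
  -- the pairing observable and its real and imaginary parts
  set H : LGConfig d G → ℂ := fun U => conj (F (configLinkReflect 0 U)) * F U with hH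
  have hHc : Continuous H :=
    (Complex.continuous_conj.comp (hFc.comp (continuous_configLinkReflect 0))).mul hFc
  set TH : Finset (ZdEdge d) := T.image (fun e => if e.2 = (0 : Fin d) then
      (zdLinkReflect 0 e.1 - Pi.single 0 1, (0 : Fin d)) else (zdLinkReflect 0 e.1, e.2)) ∪ T with hTH
  have hHcyl : IsCylinder H TH := by
    intro U V hUV
    have e1 := isCylinder_comp_configLinkReflect hFT 0 fun e he => hUV e (by
        rw [Finset.coe_union]; exact Or.inl he)
    have e2 := hFT fun e he => hUV e (by rw [Finset.coe_union]; exact Or.inr he)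
    simp only [Function.comp_apply] at e1
    simp only [hH, e1, e2]
  have hHb : ∀ U, ‖H U‖ ≤ C * C := fun U => by
    simp only [hH, norm_mul, Complex.norm_conj]
    exact mul_le_mul (hC _) (hC _) (norm_nonneg _) ((norm_nonneg (F U)).trans (hC U))
  have hre := hconv (fun U => (H U).re) TH
    (fun U V h => by simp only [hHcyl h]) (Complex.continuous_re.comp hHc)
    ⟨C * C, fun U => (Complex.abs_re_le_norm _).trans (hHb U)⟩
  have him := hconv (fun U => (H U).im) TH
    (fun U V h => by simp only [hHcyl h]) (Complex.continuous_im.comp hHc)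
    ⟨C * C, fun U => (Complex.abs_im_le_norm _).trans (hHb U)⟩
  -- the torus pairings are non-negative for large `k`
  have hev : ∀ᶠ k in atTop,
      0 ≤ wilsonExpectation (L := L k + 1) ρ β (toTorusObservable (L k + 1) (fun U => (H U).re)) ∧
      wilsonExpectation (L := L k + 1) ρ β (toTorusObservable (L k + 1) (fun U => (H U).im)) = 0 := by
    refine (htorus T' m hFT' hT1 hm).mono fun k hpos => ?_
    haveI := isProbabilityMeasure_wilsonMeasure (d := d) (L := L k + 1) (G := G) ρ hρ β
    have hint : Integrable (toTorusObservable (L k + 1) H) (wilsonMeasure (L := L k + 1) ρ β) :=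
      Integrable.of_bound ((hHc.comp (continuous_torusLift _)).measurable.aestronglyMeasurable)
        (C * C) (ae_of_all _ fun U => hHb _)
    have hE : wilsonExpectation (L := L k + 1) ρ β (fun U : GaugeConfig d (L k + 1) G =>
        conj (toTorusObservable (L k + 1) F U.timeReflect) * toTorusObservable (L k + 1) F U) =
        wilsonExpectation (L := L k + 1) ρ β (toTorusObservable (L k + 1) H) := by
      congr 1
      funext U
      simp only [hH, toTorusObservable, Function.comp_apply, torusLift_timeReflect]
    rw [hE] at hpos
    obtain ⟨h1, h2⟩ := Complex.nonneg_iff.1 hpos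
    have hre_eq : (wilsonExpectation (L := L k + 1) ρ β (toTorusObservable (L k + 1) H)).re =
        wilsonExpectation (L := L k + 1) ρ β (toTorusObservable (L k + 1) fun U => (H U).re) := by
      simp only [wilsonExpectation]
      exact (integral_re hint).symm
    have him_eq : (wilsonExpectation (L := L k + 1) ρ β (toTorusObservable (L k + 1) H)).im =
        wilsonExpectation (L := L k + 1) ρ β (toTorusObservable (L k + 1) fun U => (H U).im) := by
      simp only [wilsonExpectation]
      exact (integral_im hint).symm
    exact ⟨hre_eq ▸ h1, (him_eq ▸ h2).symm⟩
  -- pass to the limit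
  have hint : Integrable H μ :=
    Integrable.of_bound hHc.measurable.aestronglyMeasurable (C * C) (ae_of_all _ fun U => hHb _)
  have h1 : 0 ≤ ∫ U, (H U).re ∂μ := ge_of_tendsto hre (hev.mono fun k hk => hk.1)
  have h2 : ∫ U, (H U).im ∂μ = 0 := by
    refine tendsto_nhds_unique him ?_
    exact tendsto_const_nhds.congr' (hev.mono fun k hk => hk.2.symm)
  have hre' : (∫ U, H U ∂μ).re = ∫ U, (H U).re ∂μ := by
    have h := integral_re hint
    simp only [RCLike.re_to_complex] at h
    exact h.symm
  have him' : (∫ U, H U ∂μ).im = ∫ U, (H U).im ∂μ := by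
    have h := integral_im hint
    simp only [RCLike.im_to_complex] at h
    exact h.symm
  refine Complex.nonneg_iff.2 ⟨?_, ?_⟩
  · rw [hre']; exact h1
  · rw [him', h2]

variable [T2Space G]

/-- **Link RP (axis `0`) of a limit along a sequence of tori on which link RP holds for the lifts
of half-space cylinders.** With `L` strictly increasing (so that `μ` is a limit point, hence
`Θ_0`-invariant) and the torus hypothesis of `integral_linkReflect_nonneg_of_cylinder_along` for
every bounded continuous half-space cylinder observable:
`IsReflectionPositiveFor (configLinkReflect 0) (linkHalfEdges 0) μ` (the `L²` closure
`IsReflectionPositiveFor.of_continuous_cylinder`). -/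
theorem linkRP_zero_of_isInfiniteVolumeLimitAlong (hρ : Continuous ρ) {β : ℝ} {L : ℕ → ℕ}
    (hL : StrictMono L) {μ : Measure (LGConfig d G)} (hμ : IsInfiniteVolumeLimitAlong ρ β L μ)
    (htorus : ∀ (F : LGConfig d G → ℂ) (T' : Finset (ZdEdge d)) (m : ℕ), IsCylinder F T' →
      Measurable F → (∃ C : ℝ, ∀ U, ‖F U‖ ≤ C) → (∀ e ∈ T', 1 ≤ e.1 0) → (∀ e ∈ T', e.1 0 ≤ m) →
      ∀ᶠ k in atTop,
        0 ≤ wilsonExpectation (L := L k + 1) ρ β fun U : GaugeConfig d (L k + 1) G =>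
          conj (toTorusObservable (L k + 1) F U.timeReflect) * toTorusObservable (L k + 1) F U) :
    IsReflectionPositiveFor (configLinkReflect (G := G) 0) (linkHalfEdges 0) μ := by
  have hmem : μ ∈ infiniteVolumeLimitPoints (d := d) ρ β := ⟨L, hL, hμ⟩
  haveI := hμ.1
  exact IsReflectionPositiveFor.of_continuous_cylinder
    (measurePreserving_configLinkReflect_zero ρ hρ hmem)
    fun F T hFT hFc ⟨C, hC⟩ hFS => integral_linkReflect_nonneg_of_cylinder_along ρ hρ hμ hFT hFc hC
      hFS fun T' m hFT' hT1 hTm => htorus F T' m hFT' hFc.measurable ⟨C, hC⟩ hT1 hTm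

/-- **Every axis.** Under the hypotheses of `linkRP_zero_of_isInfiniteVolumeLimitAlong`, the limit
is link-RP in every link hyperplane `x_i = ½` (transport by the axis transposition `(0 i)`, under
which every limit point is invariant). -/
theorem linkRP_of_isInfiniteVolumeLimitAlong (hρ : Continuous ρ) {β : ℝ} {L : ℕ → ℕ}
    (hL : StrictMono L) {μ : Measure (LGConfig d G)} (hμ : IsInfiniteVolumeLimitAlong ρ β L μ)
    (htorus : ∀ (F : LGConfig d G → ℂ) (T' : Finset (ZdEdge d)) (m : ℕ), IsCylinder F T' →
      Measurable F → (∃ C : ℝ, ∀ U, ‖F U‖ ≤ C) → (∀ e ∈ T', 1 ≤ e.1 0) → (∀ e ∈ T', e.1 0 ≤ m) →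
      ∀ᶠ k in atTop,
        0 ≤ wilsonExpectation (L := L k + 1) ρ β fun U : GaugeConfig d (L k + 1) G =>
          conj (toTorusObservable (L k + 1) F U.timeReflect) * toTorusObservable (L k + 1) F U)
    (i : Fin d) : IsReflectionPositiveFor (configLinkReflect (G := G) i) (linkHalfEdges i) μ := by
  have hmem : μ ∈ infiniteVolumeLimitPoints (d := d) ρ β := ⟨L, hL, hμ⟩
  exact IsReflectionPositiveFor.of_conj (permInvariant_of_mem_infiniteVolumeLimitPoints ρ hρ hmem _)
    (measurable_configLinkReflect 0) (configPerm_swap_configPerm_swap i) (configLinkReflect_eq_conj i)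
    (dependsOn_comp_configPerm_linkHalf i) (linkRP_zero_of_isInfiniteVolumeLimitAlong ρ hρ hL hμ htorus)

end Transfer

/-! ## The even-torus link theorems at every real `β`, in Wave 0's vocabulary -/

section EvenTorus

variable {G : Type} [Group G] [TopologicalSpace G] [IsTopologicalGroup G] [CompactSpace G]
  [MeasurableSpace G] [BorelSpace G] [SecondCountableTopology G]
variable (ρ : G →* Matrix (Fin N) (Fin N) ℂ)

/-- **Even torus, central involution, every real `β`** (Wave 0's vocabulary): on `(ℤ/L)^d`, `L`
even, `L ≥ 4`, `d ≥ 1`, for a compact second countable `G : Type`, a central `z` with `z² = 1`, a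
continuous `ρ` with `ρ z = -1`, every real `β` and every bounded measurable positive-time observable
`F`: `0 ≤ ∫ conj F(ΘU) · F(U) dμ_β`, `Θ = timeReflect` (`CubicTorusLinkRPAnyBeta` along the axis
`0`, through `configMidReflect_cubicUnit_zero` and `isMidObservable_cubicUnit_zero_iff`). -/
theorem evenTorus_linkRP_timeReflect_anyBeta_of_central [NeZero d] {L : ℕ} [NeZero L]
    (hL : Even L) (h4 : 4 ≤ L) (hρ : Continuous ρ) {z : G} (hzc : ∀ g, z * g = g * z)
    (hz2 : z * z = 1) (hρz : ρ z = -1) (β : ℝ) (F : GaugeConfig d L G → ℂ) (hFm : Measurable F)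
    (hFb : ∃ C : ℝ, ∀ U, ‖F U‖ ≤ C) (hFo : IsPositiveTimeObservable F) :
    0 ≤ ∫ U, conj (F U.timeReflect) * F U ∂(wilsonMeasure (d := d) (L := L) ρ β) := by
  obtain ⟨Q, rfl⟩ : ∃ Q, L = 2 * Q := hL.two_dvd
  haveI : NeZero Q := ⟨by omega⟩
  have hQ : 2 ≤ Q := by omega
  have h := TiltedRP.cubicTorus_linkRP_anyBeta_of_central ρ hQ 0 hρ hzc hz2 hρz β F hFm hFb
    ((TiltedRP.isMidObservable_cubicUnit_zero_iff F).2 hFo)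
  simpa only [TiltedRP.configMidReflect_cubicUnit_zero] using h

/-- **Even two-torus, every compact `G`, every real `β`** (Wave 0's vocabulary): on `(ℤ/L)^2`,
`L` even, `L ≥ 4`, for a compact second countable `G : Type`, a continuous `ρ`, every real `β` and
every bounded measurable positive-time observable `F`: `0 ≤ ∫ conj F(ΘU) · F(U) dμ_β`
(`cubicTorus_linkRP_fin_two` along the axis `0`). -/
theorem evenTorus_linkRP_timeReflect_twoDim {L : ℕ} [NeZero L] (hL : Even L) (h4 : 4 ≤ L)
    (hρ : Continuous ρ) (β : ℝ) (F : GaugeConfig 2 L G → ℂ) (hFm : Measurable F)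
    (hFb : ∃ C : ℝ, ∀ U, ‖F U‖ ≤ C) (hFo : IsPositiveTimeObservable F) :
    0 ≤ ∫ U, conj (F U.timeReflect) * F U ∂(wilsonMeasure (d := 2) (L := L) ρ β) := by
  obtain ⟨Q, rfl⟩ : ∃ Q, L = 2 * Q := hL.two_dvd
  haveI : NeZero Q := ⟨by omega⟩
  have hQ : 2 ≤ Q := by omega
  have h := TiltedRP.cubicTorus_linkRP_fin_two ρ hQ 0 hρ β F hFm hFb
    ((TiltedRP.isMidObservable_cubicUnit_zero_iff F).2 hFo)
  simpa only [TiltedRP.configMidReflect_cubicUnit_zero] using h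

end EvenTorus

/-! ## Plain link RP of even-torus limit points at every real `β` -/

section EvenLimit

variable {G : Type} [Group G] [TopologicalSpace G] [IsTopologicalGroup G] [CompactSpace G]
  [MeasurableSpace G] [BorelSpace G] [SecondCountableTopology G] [T2Space G]
variable (ρ : G →* Matrix (Fin N) (Fin N) ℂ)

omit [T2Space G] in
/-- **The torus input along even sizes, central involution, every real `β`.** -/
theorem eventually_torus_rp_nonneg_even_of_central [NeZero d] (hρ : Continuous ρ) {z : G}
    (hzc : ∀ g, z * g = g * z) (hz2 : z * z = 1) (hρz : ρ z = -1) (β : ℝ) {φ : ℕ → ℕ}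
    (hφ : StrictMono φ) (F : LGConfig d G → ℂ) (T' : Finset (ZdEdge d)) (m : ℕ)
    (hFT : IsCylinder F T') (hFm : Measurable F) (hFb : ∃ C : ℝ, ∀ U, ‖F U‖ ≤ C)
    (hT1 : ∀ e ∈ T', 1 ≤ e.1 0) (hTm : ∀ e ∈ T', e.1 0 ≤ m) :
    ∀ᶠ k in atTop, 0 ≤ wilsonExpectation (L := 2 * φ k + 3 + 1) ρ β
      fun U : GaugeConfig d (2 * φ k + 3 + 1) G =>
        conj (toTorusObservable (2 * φ k + 3 + 1) F U.timeReflect) *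
          toTorusObservable (2 * φ k + 3 + 1) F U := by
  refine Filter.eventually_atTop.2 ⟨m, fun k hk => ?_⟩
  have hkφ : k ≤ φ k := hφ.le_apply
  have hmL : m + 1 ≤ (2 * φ k + 3 + 1) / 2 := by omega
  have hev : Even (2 * φ k + 3 + 1) := ⟨φ k + 2, by ring⟩
  unfold wilsonExpectation
  exact evenTorus_linkRP_timeReflect_anyBeta_of_central ρ hev (by omega) hρ hzc hz2 hρz β _
    (hFm.comp (measurable_torusLift _)) (hFb.imp fun C hC U => hC _)
    (isPositiveTimeObservable_toTorusObservable hFT hT1 hTm hmL)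

/-- ★★ **Even-torus limit points are plainly link-RP in every axis at EVERY real `β`, for gauge
groups with a central involution represented by `-1`** (`SU(2)`, `SU(2n)`, `U(N)` fundamental):
`G : Type` compact Hausdorff second countable, `z` central with `z² = 1`, `ρ` continuous with
`ρ z = -1`, `d ≥ 1`; `μ` the limit of the torus Wilson states along the even sizes `2φ(k) + 4`,
`φ` strictly increasing. Then `IsReflectionPositiveFor (configLinkReflect i) (linkHalfEdges i) μ`
for every axis `i` — the `linkRP` field of `ClassB.lean`, with NO sign condition on `β`. -/
theorem linkRP_of_isInfiniteVolumeLimitAlong_even_of_central [NeZero d] (hρ : Continuous ρ)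
    {z : G} (hzc : ∀ g, z * g = g * z) (hz2 : z * z = 1) (hρz : ρ z = -1) {β : ℝ} {φ : ℕ → ℕ}
    (hφ : StrictMono φ) {μ : Measure (LGConfig d G)}
    (hμ : IsInfiniteVolumeLimitAlong ρ β (fun k => 2 * φ k + 3) μ) (i : Fin d) :
    IsReflectionPositiveFor (configLinkReflect (G := G) i) (linkHalfEdges i) μ :=
  linkRP_of_isInfiniteVolumeLimitAlong ρ hρ (strictMono_evenSizes hφ) hμ
    (fun F T' m hFT hFm hFb hT1 hTm =>
      eventually_torus_rp_nonneg_even_of_central ρ hρ hzc hz2 hρz β hφ F T' m hFT hFm hFb hT1 hTm) i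

omit [T2Space G] in
/-- **The torus input along even sizes, `d = 2`, every compact `G`, every real `β`.** -/
theorem eventually_torus_rp_nonneg_even_twoDim (hρ : Continuous ρ) (β : ℝ) {φ : ℕ → ℕ}
    (hφ : StrictMono φ) (F : LGConfig 2 G → ℂ) (T' : Finset (ZdEdge 2)) (m : ℕ)
    (hFT : IsCylinder F T') (hFm : Measurable F) (hFb : ∃ C : ℝ, ∀ U, ‖F U‖ ≤ C)
    (hT1 : ∀ e ∈ T', 1 ≤ e.1 0) (hTm : ∀ e ∈ T', e.1 0 ≤ m) :
    ∀ᶠ k in atTop, 0 ≤ wilsonExpectation (L := 2 * φ k + 3 + 1) ρ β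
      fun U : GaugeConfig 2 (2 * φ k + 3 + 1) G =>
        conj (toTorusObservable (2 * φ k + 3 + 1) F U.timeReflect) *
          toTorusObservable (2 * φ k + 3 + 1) F U := by
  refine Filter.eventually_atTop.2 ⟨m, fun k hk => ?_⟩
  have hkφ : k ≤ φ k := hφ.le_apply
  have hmL : m + 1 ≤ (2 * φ k + 3 + 1) / 2 := by omega
  have hev : Even (2 * φ k + 3 + 1) := ⟨φ k + 2, by ring⟩
  unfold wilsonExpectation
  exact evenTorus_linkRP_timeReflect_twoDim ρ hev (by omega) hρ β _
    (hFm.comp (measurable_torusLift _)) (hFb.imp fun C hC U => hC _)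
    (isPositiveTimeObservable_toTorusObservable hFT hT1 hTm hmL)

/-- ★★ **Even two-torus limit points are plainly link-RP in both axes at EVERY real `β`, for every
compact gauge group**: `G : Type` compact Hausdorff second countable, `ρ` continuous, `d = 2`; `μ`
the limit of the torus Wilson states along the even sizes `2φ(k) + 4`. -/
theorem linkRP_of_isInfiniteVolumeLimitAlong_even_twoDim (hρ : Continuous ρ) {β : ℝ} {φ : ℕ → ℕ}
    (hφ : StrictMono φ) {μ : Measure (LGConfig 2 G)}
    (hμ : IsInfiniteVolumeLimitAlong ρ β (fun k => 2 * φ k + 3) μ) (i : Fin 2) :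
    IsReflectionPositiveFor (configLinkReflect (G := G) i) (linkHalfEdges i) μ :=
  linkRP_of_isInfiniteVolumeLimitAlong ρ hρ (strictMono_evenSizes hφ) hμ
    (fun F T' m hFT hFm hFb hT1 hTm =>
      eventually_torus_rp_nonneg_even_twoDim ρ hρ β hφ F T' m hFT hFm hFb hT1 hTm) i

end EvenLimit

end Summit.QuantumFields.GaugeBoot
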